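import Summits.QuantumFields.YangMills.Theorems.UnitScaleTiltProp7TrueLinPureGaugeIter
import Summits.QuantumFields.YangMills.Theorems.UnitScaleTiltProp7AvgTrueLinearisationDiff
import HarnessLib

/-!
# Route `UnitScaleTilt`, crux K1 «MinimiserStabilityRegPr» (stmt-QuantumFields-19200), route-R row (R-δ) (★p1 g12 2026-08-28), FILE 1 of 2 —
# THE BRIDGE BETWEEN THE CELL'S TWO CONSTRAINT CURRENCIES: the algebraic true-linearisation family `Q k` (`hQ0 ∕ hQs`, the letters of ✓ p606268 ∕ p622368 ∕ p625333)
# IS the derivative of the `k`-fold (0.4)-average ratio along ANY bondwise-differentiable family, `(d∕ds)|₀ [avg^k(Γ s)(c)·(avg^k U₀(c))*] = (Q k A)(c)`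

Cell `ym3-torus`, keyed width hand `ym-routeR-w2` (gen 1).  THEOREMS ONLY (0 `def`, 0 `sorry`); `--supports stmt-QuantumFields-19200`, count-neutral.  YM₃ on T³ is a ladder
rung (R3), not the Clay problem; nothing here claims a stub, the crux, d = 4 or the mass gap.

WHY.  The S-side of the cell works in CURVE currency (`Prop7FirstVariationMultiplier.abs_lin_le_constraint_velocity`: the first variation at an R2-critical `U₀` is bounded by
`2ε₀ℓ⁻¹·Σ_c‖(d∕ds)|₀ avg^{K−n}(Γ₀ s)(c)‖` for every bondwise-differentiable family `Γ₀` through `U₀`), the P-side ∕ route-R core in the ALGEBRAIC currency `Q` (the recursion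
family of the written-out true one-step linearisations along the background tower, linear by `Prop7TrueLinPureGaugeIter.trueLinIter_add ∕ _smul`, exact on pure gauges by
`trueLinIter_pureGauge`).  The two are tied in the tree only through the NONLINEAR one-step remainder `Prop7HolRatioPerStep.norm_avgFun_ratio_sub_one_sub_trueLin_le`
(`‖avgFun U(c)·(avgFun U₀(c))* − 1 − T_{U₀}(pertVar U₀ U)(c)‖ ≤ 260m²`).  This file turns that remainder into the DERIVATIVE identity, with no product-rule calculus: along a
family `Γ` with ratio velocities `A` the walk masses are `O(s)`, so the remainder is `O(s²) = o(s)`, and the written-out `T_{U₀}` — a linear map of a finite-dimensional space —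
carries `pertVar U₀ (Γ s) = s·A + o(s)` to `s·T_{U₀}(A) + o(s)`.  Iterating along the tower gives the `k`-fold identity for every recursion family `Q`.

WHAT IS PROVED (ns `…Theorems.Prop7TrueLinIterHasDeriv`; any `Params`, `SU(n)`).
* §1 `hasDerivAt_zero_of_norm_le_mul_sq` (little-o bookkeeping), `list_sum_map_le_length_mul_sum` (walk mass ≤ length × total mass).
* §2 ★ `hasDerivAt_avgFun_ratio` — one step: `Γ 0 = U₀`, `HasDerivAt (s ↦ Γ s b·(U₀ b)*) (A b) 0` at every bond, background loop variables within `α ≤ 1∕24`, `α < δ_n`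
  ⟹ `HasDerivAt (s ↦ avgFun ℰ (Γ s) c·(avgFun ℰ U₀ c)*) (T_{U₀}(A)(c)) 0`.
* §3 ★★ `hasDerivAt_iter_ratio` — `k`-fold, for every recursion family `Q` (`hQ0 ∕ hQs` VERBATIM `Prop7FibreTrueLinDefect`'s generic letters) under the displayed tower rows
  `hα ∕ ha24 ∕ haN` (idem, `haN` strict): `∀ c, HasDerivAt (s ↦ avg^k(Γ s)(c)·(avg^k U₀ c)*) (Q k A c) 0`, and `deriv_iter_eq` (the `deriv` of the average itself is `(Q k A c)·avg^k U₀(c)`).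

HONEST SCOPE.  Elementary asymptotics over the landed remainder theorem; the tower rows stay displayed (discharged on T³ by the consumers' `tower_plaq_lt` regime).

References: T. Bałaban, CMP 98 (1985) 17–51 [Balaban1985Averaging] (Prop. 3 (122)–(125) p.36, (11) p.19); CMP 109 (1987) 249–301 [Balaban1987RG1] ((0.4), (0.11) p.253);
CMP 102 (1985) 277–309 [Balaban1985Variational] ((15) p.280, (141)–(143) p.299).
-/

set_option autoImplicit false

noncomputable section

open scoped BigOperators Matrix.Norms.L2Operator Topology

namespace Summit.QuantumFields.YangMills.Theorems.Prop7TrueLinIterHasDeriv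

open Filter Asymptotics
open Literature.MathematicalPhysics.QuantumFieldTheory.Balaban1983to89
open T4Continuum BlockAveraging AveragingRT ExpMeanLog BlockAveragingEMLLinearised BlockAveragingEMLLinearisedBackground BlockAveragingEMLProp2
open Summit.QuantumFields.YangMills.Theorems.Prop7HolRatioPerStep (norm_avgFun_ratio_sub_one_sub_trueLin_le norm_coe_eq_one norm_star_coe_eq_one coe_mul_star_self)
open Summit.QuantumFields.YangMills.Theorems.Prop7TrueLinPureGaugeIter (trueLin_add trueLin_smul iter_succ_apply)

variable {P : Params} {n : Type*} [Fintype n] [DecidableEq n] [Nonempty n]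

/-! ## §1 Bookkeeping -/

omit [Fintype n] [DecidableEq n] [Nonempty n] in
/-- A function vanishing at `0` and bounded by `C·s²` near `0` has derivative `0` at `0`. [folklore] -/
theorem hasDerivAt_zero_of_norm_le_mul_sq {E : Type*} [NormedAddCommGroup E] [NormedSpace ℝ E] {f : ℝ → E} {C : ℝ} (h0 : f 0 = 0)
    (hb : ∀ᶠ s in 𝓝 (0 : ℝ), ‖f s‖ ≤ C * s ^ 2) : HasDerivAt f 0 0 := by
  rw [hasDerivAt_iff_isLittleO_nhds_zero]
  simp only [zero_add, h0, sub_zero, smul_zero]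
  have h1 : f =O[𝓝 (0 : ℝ)] fun s : ℝ => s ^ 2 := by
    refine IsBigO.of_bound C ?_
    filter_upwards [hb] with s hs
    simpa only [norm_pow, Real.norm_eq_abs, sq_abs] using hs
  have h2 : (fun s : ℝ => s ^ 2) =o[𝓝 (0 : ℝ)] fun s : ℝ => s := by
    simpa only [pow_one] using (isLittleO_pow_pow (𝕜 := ℝ) (show 1 < 2 by norm_num))
  exact h1.trans_isLittleO h2

omit [Nonempty n] in
/-- A walk mass is at most the walk length times the total mass: `Σ_{s∈Γ}‖Y_{b(s)}‖ ≤ |Γ|·Σ_b‖Y_b‖`. [folklore] -/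
theorem list_sum_map_le_length_mul_sum {j : ℕ} (Y : PBond P j → Matrix n n ℂ) (γ : List (LStep P j)) :
    (γ.map fun s => ‖Y s.bond‖).sum ≤ (γ.length : ℝ) * ∑ b : PBond P j, ‖Y b‖ := by
  have h : ∀ x ∈ γ.map fun s => ‖Y s.bond‖, x ≤ ∑ b : PBond P j, ‖Y b‖ := by
    intro x hx
    obtain ⟨s, _, rfl⟩ := List.mem_map.mp hx
    exact Finset.single_le_sum (f := fun b => ‖Y b‖) (fun b _ => norm_nonneg _) (Finset.mem_univ s.bond)
  have := List.sum_le_card_nsmul _ _ h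
  simpa only [List.length_map, nsmul_eq_mul] using this

/-! ## §2 ★ One step: the derivative of the (0.4)-average ratio is the written-out true linearisation -/

/-- ★ **THE TRUE ONE-STEP LINEARISATION IS THE DERIVATIVE OF THE AVERAGE RATIO.**  Background `U₀` whose (0.4) loop variables at the coarse bond `c` are within `α ≤ 1∕24` of `1`,
`α < δ_n`; a family `Γ` of `SU(n)` fields with `Γ 0 = U₀` whose bond ratios `Γ(s)_b·U₀(b)*` have derivatives `A_b` at `s = 0`.  Then
`s ↦ avgFun ℰ (Γ s)(c)·(avgFun ℰ U₀ (c))*` has derivative `T_{U₀}(A)(c) = D eml(W₀)[i ↦ A_{U₀}(loop_i)·W₀,i]·κ₀* + κ₀·A_{U₀}([y,y′])·κ₀*` at `0` — the letter of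
`Prop7HolRatioPerStep.norm_avgFun_ratio_sub_one_sub_trueLin_le`, whose `260m²` remainder is `o(s)` along the family. [cite: Balaban1985Averaging, Prop. 3 (122)-(125) p.36] -/
theorem hasDerivAt_avgFun_ratio {j : ℕ} (U₀ : GaugeField P j (Matrix.specialUnitaryGroup n ℂ)) (Γ : ℝ → GaugeField P j (Matrix.specialUnitaryGroup n ℂ))
    (hΓ0 : Γ 0 = U₀) (A : PBond P j → Matrix n n ℂ)
    (hA : ∀ b : PBond P j, HasDerivAt (fun s : ℝ => ((Γ s b : Matrix.specialUnitaryGroup n ℂ) : Matrix n n ℂ) * star ((U₀ b : Matrix.specialUnitaryGroup n ℂ) : Matrix n n ℂ)) (A b) 0)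
    (c : PBond P (j + 1)) {α : ℝ} (hα : ∀ i, dist1 (loopHol U₀ c i) ≤ α) (hα24 : α ≤ 1 / 24) (hαN : α < deltaSU n) :
    HasDerivAt (fun s : ℝ => ((avgFun (expMeanLogSU (n := n)) (Γ s) c : Matrix.specialUnitaryGroup n ℂ) : Matrix n n ℂ) *
        star ((avgFun (expMeanLogSU (n := n)) U₀ c : Matrix.specialUnitaryGroup n ℂ) : Matrix n n ℂ))
      (fderiv ℂ (eml : (Idx P → Matrix n n ℂ) → Matrix n n ℂ) (fun i => ((loopHol U₀ c i : Matrix.specialUnitaryGroup n ℂ) : Matrix n n ℂ))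
          (fun i => covWalkSum U₀ A (walk (emb c.src) (loopWord P.L c.dir (off i.1) i.2.1 i.2.2))
            * ((loopHol U₀ c i : Matrix.specialUnitaryGroup n ℂ) : Matrix n n ℂ))
          * star ((corr (expMeanLogSU (n := n)) U₀ c : Matrix.specialUnitaryGroup n ℂ) : Matrix n n ℂ)
        + ((corr (expMeanLogSU (n := n)) U₀ c : Matrix.specialUnitaryGroup n ℂ) : Matrix n n ℂ)
          * covWalkSum U₀ A (walk (emb c.src) (List.replicate P.L (c.dir, true)))
          * star ((corr (expMeanLogSU (n := n)) U₀ c : Matrix.specialUnitaryGroup n ℂ) : Matrix n n ℂ)) 0 := by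
  classical
  -- the written-out operator as a `ℂ`-linear (hence continuous) map of the bond field
  let T : (PBond P j → Matrix n n ℂ) →ₗ[ℂ] Matrix n n ℂ :=
    { toFun := fun Z =>
        fderiv ℂ (eml : (Idx P → Matrix n n ℂ) → Matrix n n ℂ) (fun i => ((loopHol U₀ c i : Matrix.specialUnitaryGroup n ℂ) : Matrix n n ℂ))
            (fun i => covWalkSum U₀ Z (walk (emb c.src) (loopWord P.L c.dir (off i.1) i.2.1 i.2.2))
              * ((loopHol U₀ c i : Matrix.specialUnitaryGroup n ℂ) : Matrix n n ℂ))
            * star ((corr (expMeanLogSU (n := n)) U₀ c : Matrix.specialUnitaryGroup n ℂ) : Matrix n n ℂ)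
          + ((corr (expMeanLogSU (n := n)) U₀ c : Matrix.specialUnitaryGroup n ℂ) : Matrix n n ℂ)
            * covWalkSum U₀ Z (walk (emb c.src) (List.replicate P.L (c.dir, true)))
            * star ((corr (expMeanLogSU (n := n)) U₀ c : Matrix.specialUnitaryGroup n ℂ) : Matrix n n ℂ)
      map_add' := fun Z Z' => trueLin_add U₀ Z Z' c
      map_smul' := fun a Z => trueLin_smul U₀ a Z c }
  let Tc : (PBond P j → Matrix n n ℂ) →L[ℝ] Matrix n n ℂ := LinearMap.toContinuousLinearMap (T.restrictScalars ℝ)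
  have hTc : ∀ Z, Tc Z = T Z := fun Z => rfl
  -- the ratio field along the family and its derivative in the product space
  set Y : ℝ → PBond P j → Matrix n n ℂ := fun s => pertVar U₀ (Γ s) with hYdef
  have hYb : ∀ s b, Y s b = ((Γ s b : Matrix.specialUnitaryGroup n ℂ) : Matrix n n ℂ) * star ((U₀ b : Matrix.specialUnitaryGroup n ℂ) : Matrix n n ℂ) - 1 :=
    fun s b => pertVar_eq U₀ (Γ s) b
  have hY0 : Y 0 = 0 := by
    funext b; rw [hYb, hΓ0, coe_mul_star_self, sub_self]; rfl
  have hYd : HasDerivAt Y A 0 := by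
    rw [hasDerivAt_pi]
    intro b
    have h := (hA b).sub_const (1 : Matrix n n ℂ)
    refine h.congr_of_eventuallyEq (Eventually.of_forall fun s => ?_)
    exact hYb s b
  -- the linear part has derivative `T A`
  have hlin : HasDerivAt (fun s : ℝ => Tc (Y s)) (Tc A) 0 := Tc.hasFDerivAt.comp_hasDerivAt (0 : ℝ) hYd
  -- the remainder `E(s) = ratio − 1 − T(Y s)` is `O(s²)`
  set R : ℝ → Matrix n n ℂ := fun s => ((avgFun (expMeanLogSU (n := n)) (Γ s) c : Matrix.specialUnitaryGroup n ℂ) : Matrix n n ℂ) *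
        star ((avgFun (expMeanLogSU (n := n)) U₀ c : Matrix.specialUnitaryGroup n ℂ) : Matrix n n ℂ) with hRdef
  have hR0 : R 0 = 1 := by rw [hRdef]; simp only [hΓ0, coe_mul_star_self]
  -- walk lengths and the `O(s)` size of the walk masses
  let Nmax : ℕ := (Finset.univ.sup fun i : Idx P => (walk (emb c.src) (loopWord P.L c.dir (off i.1) i.2.1 i.2.2)).length)
    ⊔ (walk (emb c.src) (List.replicate P.L (c.dir, true))).length
  have hNL : ∀ i : Idx P, (walk (emb c.src) (loopWord P.L c.dir (off i.1) i.2.1 i.2.2)).length ≤ Nmax :=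
    fun i => (Finset.le_sup (f := fun i : Idx P => (walk (emb c.src) (loopWord P.L c.dir (off i.1) i.2.1 i.2.2)).length) (Finset.mem_univ i)).trans le_sup_left
  have hNS : (walk (emb c.src) (List.replicate P.L (c.dir, true))).length ≤ Nmax := le_sup_right
  -- bondwise linear bounds near `0`
  have hbd : ∀ b : PBond P j, ∃ C : ℝ, 0 ≤ C ∧ ∀ᶠ s in 𝓝 (0 : ℝ), ‖Y s b‖ ≤ C * |s| := by
    intro b
    have hd : HasDerivAt (fun s => Y s b) (A b) 0 := (hasDerivAt_pi.mp hYd) b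
    obtain ⟨C, hC, hb⟩ := hd.isBigO_sub.exists_nonneg
    refine ⟨C, hC, ?_⟩
    filter_upwards [hb.bound] with s hs
    have e : Y s b - Y 0 b = Y s b := by rw [hY0]; exact sub_zero _
    simpa only [e, sub_zero, Real.norm_eq_abs] using hs
  choose C hC0 hCb using hbd
  set S : ℝ := ∑ b : PBond P j, C b with hSdef
  have hS0 : 0 ≤ S := Finset.sum_nonneg fun b _ => hC0 b
  have hsum : ∀ᶠ s in 𝓝 (0 : ℝ), ∑ b : PBond P j, ‖Y s b‖ ≤ S * |s| := by
    have hall : ∀ᶠ s in 𝓝 (0 : ℝ), ∀ b : PBond P j, ‖Y s b‖ ≤ C b * |s| := eventually_all.mpr fun b => hCb b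
    filter_upwards [hall] with s hs
    calc ∑ b : PBond P j, ‖Y s b‖ ≤ ∑ b : PBond P j, C b * |s| := Finset.sum_le_sum fun b _ => hs b
      _ = S * |s| := by rw [hSdef, Finset.sum_mul]
  -- the smallness window
  have hgap : 0 < deltaSU n - α := sub_pos.mpr hαN
  obtain ⟨ρ, hρ0, hρ⟩ : ∃ ρ : ℝ, 0 < ρ ∧ (Nmax : ℝ) * S * ρ ≤ min (1 / 72) ((deltaSU n - α) / 4) := by
    have hm0 : 0 < min (1 / 72 : ℝ) ((deltaSU n - α) / 4) := lt_min (by norm_num) (by linarith)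
    by_cases hNS0 : (Nmax : ℝ) * S = 0
    · exact ⟨1, one_pos, by rw [hNS0, zero_mul]; exact hm0.le⟩
    · have hpos : 0 < (Nmax : ℝ) * S := lt_of_le_of_ne (by positivity) (Ne.symm hNS0)
      refine ⟨min (1 / 72 : ℝ) ((deltaSU n - α) / 4) / ((Nmax : ℝ) * S), div_pos hm0 hpos, ?_⟩
      rw [mul_div_cancel₀ _ hNS0]
  have hsmall : ∀ᶠ s in 𝓝 (0 : ℝ), |s| < ρ := by
    have : ∀ᶠ s in 𝓝 (0 : ℝ), s ∈ Metric.ball (0 : ℝ) ρ := Metric.ball_mem_nhds 0 hρ0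
    filter_upwards [this] with s hs
    simpa only [Metric.mem_ball, dist_zero_right, Real.norm_eq_abs] using hs
  -- the remainder bound near `0`
  have hrem : ∀ᶠ s in 𝓝 (0 : ℝ), ‖R s - 1 - Tc (Y s)‖ ≤ (260 * ((Nmax : ℝ) * S) ^ 2) * s ^ 2 := by
    filter_upwards [hsum, hsmall] with s hs hsρ
    set m : ℝ := (Nmax : ℝ) * S * |s| with hmdef
    have hm0 : 0 ≤ m := by positivity
    have hmle : m ≤ min (1 / 72) ((deltaSU n - α) / 4) :=
      (mul_le_mul_of_nonneg_left hsρ.le (by positivity)).trans hρ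
    have hm72 : 72 * m ≤ 1 := by have := hmle.trans (min_le_left _ _); linarith
    have hmN : 3 * m + α < deltaSU n := by have := hmle.trans (min_le_right _ _); linarith
    have hwalk : ∀ γ : List (LStep P j), γ.length ≤ Nmax → (γ.map fun st => ‖pertVar U₀ (Γ s) st.bond‖).sum ≤ m := by
      intro γ hγ
      calc (γ.map fun st => ‖pertVar U₀ (Γ s) st.bond‖).sum ≤ (γ.length : ℝ) * ∑ b : PBond P j, ‖pertVar U₀ (Γ s) b‖ :=
            list_sum_map_le_length_mul_sum _ γ
        _ ≤ (Nmax : ℝ) * (S * |s|) := mul_le_mul (by exact_mod_cast hγ) hs (Finset.sum_nonneg fun _ _ => norm_nonneg _) (by positivity)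
        _ = m := by rw [hmdef]; ring
    have hmain := norm_avgFun_ratio_sub_one_sub_trueLin_le U₀ (Γ s) c (fun i => hwalk _ (hNL i)) (hwalk _ hNS) hm72 hα hα24 hmN
    have e : R s - 1 - Tc (Y s) = ((avgFun (expMeanLogSU (n := n)) (Γ s) c : Matrix.specialUnitaryGroup n ℂ) : Matrix n n ℂ) *
          star ((avgFun (expMeanLogSU (n := n)) U₀ c : Matrix.specialUnitaryGroup n ℂ) : Matrix n n ℂ) - 1 -
        (fderiv ℂ (eml : (Idx P → Matrix n n ℂ) → Matrix n n ℂ) (fun i => ((loopHol U₀ c i : Matrix.specialUnitaryGroup n ℂ) : Matrix n n ℂ))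
            (fun i => covWalkSum U₀ (pertVar U₀ (Γ s)) (walk (emb c.src) (loopWord P.L c.dir (off i.1) i.2.1 i.2.2))
              * ((loopHol U₀ c i : Matrix.specialUnitaryGroup n ℂ) : Matrix n n ℂ))
            * star ((corr (expMeanLogSU (n := n)) U₀ c : Matrix.specialUnitaryGroup n ℂ) : Matrix n n ℂ)
          + ((corr (expMeanLogSU (n := n)) U₀ c : Matrix.specialUnitaryGroup n ℂ) : Matrix n n ℂ)
            * covWalkSum U₀ (pertVar U₀ (Γ s)) (walk (emb c.src) (List.replicate P.L (c.dir, true)))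
            * star ((corr (expMeanLogSU (n := n)) U₀ c : Matrix.specialUnitaryGroup n ℂ) : Matrix n n ℂ)) := rfl
    rw [e]
    calc _ ≤ 260 * m ^ 2 := hmain
      _ = (260 * ((Nmax : ℝ) * S) ^ 2) * |s| ^ 2 := by rw [hmdef]; ring
      _ = (260 * ((Nmax : ℝ) * S) ^ 2) * s ^ 2 := by rw [sq_abs]
  have hE : HasDerivAt (fun s : ℝ => R s - 1 - Tc (Y s)) 0 0 := by
    refine hasDerivAt_zero_of_norm_le_mul_sq ?_ hrem
    simp only [hR0, hY0, map_zero, sub_self]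
  -- assemble: `R = (R − 1 − T Y) + T Y + 1`
  have hfin : HasDerivAt (fun s : ℝ => R s - 1 - Tc (Y s) + Tc (Y s) + 1) (0 + Tc A) 0 := (hE.add hlin).add_const (1 : Matrix n n ℂ)
  simp only [sub_add_cancel, zero_add] at hfin
  convert hfin using 1
  rw [hTc]
  rfl

/-! ## §3 ★★ The `k`-fold identity along the background tower -/

/-- ★★ **THE `k`-FOLD TRUE LINEARISATION IS THE DERIVATIVE OF THE `k`-FOLD AVERAGE RATIO.**  Let `Q k` be ANY recursion family of the written-out true one-step linearisations
along the background tower `Ū₀^{(j)} = Averaging.iter (blockAvg ℰ) j U₀` (`hQ0 ∕ hQs`, the letters of `Prop7FibreTrueLinDefect` ∕ `Prop7CurvedLandauCoreFinalT3`), let the tower's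
(0.4) loop variables lie within `a_j ≤ 1∕24`, `a_j < δ_n` of `1` for `j < k`, and let `Γ` be a family of finest `SU(n)` fields with `Γ 0 = U₀` whose bond ratios have derivatives `A`.
Then at every level-`k` bond `c`: `HasDerivAt (s ↦ avg^k(Γ s)(c)·(avg^k U₀ (c))*) (Q k A c) 0`. [cite: Balaban1985Averaging, (11) p.19, Prop. 3 (122)-(125) p.36; Balaban1987RG1, (0.11) p.253] -/
theorem hasDerivAt_iter_ratio (U₀ : GaugeField P 0 (Matrix.specialUnitaryGroup n ℂ)) (Γ : ℝ → GaugeField P 0 (Matrix.specialUnitaryGroup n ℂ)) (hΓ0 : Γ 0 = U₀)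
    (A : PBond P 0 → Matrix n n ℂ)
    (hA : ∀ b : PBond P 0, HasDerivAt (fun s : ℝ => ((Γ s b : Matrix.specialUnitaryGroup n ℂ) : Matrix n n ℂ) * star ((U₀ b : Matrix.specialUnitaryGroup n ℂ) : Matrix n n ℂ)) (A b) 0)
    (Q : (k : ℕ) → (PBond P 0 → Matrix n n ℂ) → PBond P k → Matrix n n ℂ) (hQ0 : ∀ Y, Q 0 Y = Y)
    (hQs : ∀ (k : ℕ) (Y : PBond P 0 → Matrix n n ℂ) (c : PBond P (k + 1)), Q (k + 1) Y c = (fderiv ℂ (eml : (Idx P → Matrix n n ℂ) → Matrix n n ℂ)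
            (fun i => ((loopHol (Averaging.iter (fun i => blockAvg (P := P) (j := i) (expMeanLogSU (n := n))) k U₀) c i : Matrix.specialUnitaryGroup n ℂ) : Matrix n n ℂ))
            (fun i => covWalkSum (Averaging.iter (fun i => blockAvg (P := P) (j := i) (expMeanLogSU (n := n))) k U₀) (Q k Y) (walk (emb c.src) (loopWord P.L c.dir (off i.1) i.2.1 i.2.2))
              * ((loopHol (Averaging.iter (fun i => blockAvg (P := P) (j := i) (expMeanLogSU (n := n))) k U₀) c i : Matrix.specialUnitaryGroup n ℂ) : Matrix n n ℂ))
            * star ((corr (expMeanLogSU (n := n)) (Averaging.iter (fun i => blockAvg (P := P) (j := i) (expMeanLogSU (n := n))) k U₀) c : Matrix.specialUnitaryGroup n ℂ) : Matrix n n ℂ)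
          + ((corr (expMeanLogSU (n := n)) (Averaging.iter (fun i => blockAvg (P := P) (j := i) (expMeanLogSU (n := n))) k U₀) c : Matrix.specialUnitaryGroup n ℂ) : Matrix n n ℂ)
            * covWalkSum (Averaging.iter (fun i => blockAvg (P := P) (j := i) (expMeanLogSU (n := n))) k U₀) (Q k Y) (walk (emb c.src) (List.replicate P.L (c.dir, true)))
            * star ((corr (expMeanLogSU (n := n)) (Averaging.iter (fun i => blockAvg (P := P) (j := i) (expMeanLogSU (n := n))) k U₀) c : Matrix.specialUnitaryGroup n ℂ) : Matrix n n ℂ)))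
    (a : ℕ → ℝ) :
    ∀ k : ℕ,
      (∀ j < k, ∀ (c : PBond P (j + 1)) (i : Idx P), dist1 (loopHol (Averaging.iter (fun i => blockAvg (P := P) (j := i) (expMeanLogSU (n := n))) j U₀) c i) ≤ a j) →
      (∀ j < k, a j ≤ 1 / 24) → (∀ j < k, a j < deltaSU n) →
      ∀ c : PBond P k, HasDerivAt (fun s : ℝ =>
          ((Averaging.iter (fun i => blockAvg (P := P) (j := i) (expMeanLogSU (n := n))) k (Γ s) c : Matrix.specialUnitaryGroup n ℂ) : Matrix n n ℂ) *
            star ((Averaging.iter (fun i => blockAvg (P := P) (j := i) (expMeanLogSU (n := n))) k U₀ c : Matrix.specialUnitaryGroup n ℂ) : Matrix n n ℂ))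
        (Q k A c) 0 := by
  intro k
  induction k with
  | zero =>
    intro _ _ _ c
    rw [hQ0]
    exact hA c
  | succ k ih =>
    intro hα ha24 haN c
    have ih' := ih (fun j hj => hα j (Nat.lt_succ_of_lt hj)) (fun j hj => ha24 j (Nat.lt_succ_of_lt hj)) (fun j hj => haN j (Nat.lt_succ_of_lt hj))
    have h := hasDerivAt_avgFun_ratio (Averaging.iter (fun i => blockAvg (P := P) (j := i) (expMeanLogSU (n := n))) k U₀)
      (fun s => Averaging.iter (fun i => blockAvg (P := P) (j := i) (expMeanLogSU (n := n))) k (Γ s)) (by simp only [hΓ0]) (Q k A) ih' c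
      (hα k (Nat.lt_succ_self k) c) (ha24 k (Nat.lt_succ_self k)) (haN k (Nat.lt_succ_self k))
    rw [hQs]
    simpa only [iter_succ_apply] using h

/-- **COROLLARY: THE VELOCITY OF THE `k`-FOLD AVERAGE ITSELF** is `(Q k A)(c)·avg^k U₀(c)` — the letter read by `Prop7FirstVariationMultiplier.abs_lin_le_constraint_velocity`
(`deriv (s ↦ avg^{K−n}(Γ₀ s)(c)) 0`). [cite: Balaban1985Averaging, (11) p.19; Balaban1987RG1, (0.11) p.253] -/
theorem hasDerivAt_iter (U₀ : GaugeField P 0 (Matrix.specialUnitaryGroup n ℂ)) (Γ : ℝ → GaugeField P 0 (Matrix.specialUnitaryGroup n ℂ)) (hΓ0 : Γ 0 = U₀)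
    (A : PBond P 0 → Matrix n n ℂ)
    (hA : ∀ b : PBond P 0, HasDerivAt (fun s : ℝ => ((Γ s b : Matrix.specialUnitaryGroup n ℂ) : Matrix n n ℂ) * star ((U₀ b : Matrix.specialUnitaryGroup n ℂ) : Matrix n n ℂ)) (A b) 0)
    (Q : (k : ℕ) → (PBond P 0 → Matrix n n ℂ) → PBond P k → Matrix n n ℂ) (hQ0 : ∀ Y, Q 0 Y = Y)
    (hQs : ∀ (k : ℕ) (Y : PBond P 0 → Matrix n n ℂ) (c : PBond P (k + 1)), Q (k + 1) Y c = (fderiv ℂ (eml : (Idx P → Matrix n n ℂ) → Matrix n n ℂ)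
            (fun i => ((loopHol (Averaging.iter (fun i => blockAvg (P := P) (j := i) (expMeanLogSU (n := n))) k U₀) c i : Matrix.specialUnitaryGroup n ℂ) : Matrix n n ℂ))
            (fun i => covWalkSum (Averaging.iter (fun i => blockAvg (P := P) (j := i) (expMeanLogSU (n := n))) k U₀) (Q k Y) (walk (emb c.src) (loopWord P.L c.dir (off i.1) i.2.1 i.2.2))
              * ((loopHol (Averaging.iter (fun i => blockAvg (P := P) (j := i) (expMeanLogSU (n := n))) k U₀) c i : Matrix.specialUnitaryGroup n ℂ) : Matrix n n ℂ))
            * star ((corr (expMeanLogSU (n := n)) (Averaging.iter (fun i => blockAvg (P := P) (j := i) (expMeanLogSU (n := n))) k U₀) c : Matrix.specialUnitaryGroup n ℂ) : Matrix n n ℂ)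
          + ((corr (expMeanLogSU (n := n)) (Averaging.iter (fun i => blockAvg (P := P) (j := i) (expMeanLogSU (n := n))) k U₀) c : Matrix.specialUnitaryGroup n ℂ) : Matrix n n ℂ)
            * covWalkSum (Averaging.iter (fun i => blockAvg (P := P) (j := i) (expMeanLogSU (n := n))) k U₀) (Q k Y) (walk (emb c.src) (List.replicate P.L (c.dir, true)))
            * star ((corr (expMeanLogSU (n := n)) (Averaging.iter (fun i => blockAvg (P := P) (j := i) (expMeanLogSU (n := n))) k U₀) c : Matrix.specialUnitaryGroup n ℂ) : Matrix n n ℂ)))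
    (a : ℕ → ℝ) {k : ℕ}
    (hα : ∀ j < k, ∀ (c : PBond P (j + 1)) (i : Idx P), dist1 (loopHol (Averaging.iter (fun i => blockAvg (P := P) (j := i) (expMeanLogSU (n := n))) j U₀) c i) ≤ a j)
    (ha24 : ∀ j < k, a j ≤ 1 / 24) (haN : ∀ j < k, a j < deltaSU n) (c : PBond P k) :
    HasDerivAt (fun s : ℝ => ((Averaging.iter (fun i => blockAvg (P := P) (j := i) (expMeanLogSU (n := n))) k (Γ s) c : Matrix.specialUnitaryGroup n ℂ) : Matrix n n ℂ))
      (Q k A c * ((Averaging.iter (fun i => blockAvg (P := P) (j := i) (expMeanLogSU (n := n))) k U₀ c : Matrix.specialUnitaryGroup n ℂ) : Matrix n n ℂ)) 0 := by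
  have h := (hasDerivAt_iter_ratio U₀ Γ hΓ0 A hA Q hQ0 hQs a k hα ha24 haN c).mul_const
    ((Averaging.iter (fun i => blockAvg (P := P) (j := i) (expMeanLogSU (n := n))) k U₀ c : Matrix.specialUnitaryGroup n ℂ) : Matrix n n ℂ)
  refine h.congr_of_eventuallyEq (Eventually.of_forall fun s => ?_)
  simp only [Matrix.mul_assoc, Prop7HolRatioPerStep.coe_star_mul_self, Matrix.mul_one]

end Summit.QuantumFields.YangMills.Theorems.Prop7TrueLinIterHasDeriv

end
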